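import Literature.MathematicalPhysics.QuantumFieldTheory.Balaban1983to89.B16Cor3Torus
import Literature.MathematicalPhysics.QuantumFieldTheory.Balaban1983to89.B14Thm2
import Literature.MathematicalPhysics.QuantumFieldTheory.Balaban1983to89.B16Sect1Wilson

/-!
# `Balaban1983to89.B16Cor3ActionBounds` — [Balaban1988Convergent] (2.49) p. 264 ⇒ the two EFFECTIVE-ACTION
# hypotheses of the Corollary 3 chain ([Balaban1989LargeFieldII] (0.1) ∕ [III] (2.50)): the lower bookkeeping `hA′`
# (on the all-small support) and the upper `hA′up` of `B16Cor3Ops.Repr172.uvIneq_of_repr172`, with «the logarithmic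
# terms» DISPLAYED as the `g_k`-dependent constant they are — cell GAPS G-adv3-2 (L2) ∕ G-r2.7 made kernel text

statement-level skeleton of published theorems with citation tags; proofs where landed; nothing here is a claim about
the Yang–Mills mass gap.

CITATION HEADER (lean-in-tree rule 2026-08-18).  Sources under audit: T. Bałaban, *Convergent renormalization expansions
for lattice gauge theories*, Commun. Math. Phys. **119**, 243–285 (1988) [Balaban1988Convergent] = [III] (cell paper B14;
pp. 258 (2.23), 263–264 (2.43)–(2.50) — the typed leaves `B14Thm2.Eq223` ∕ `Ineq249` ∕ `ineq249_of_223` quote them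
verbatim), and *Large field renormalization. II*, ibid. **122**, 355–392 (1989) [Balaban1989LargeFieldII] = [V] (B16;
(0.1) p. 356, (1.10) p. 358 `B16Sect1Wilson.Ek110`, p. 387 after (1.89)).  Nothing of the manuscripts is asserted: every
input is a binder in the tree's own typed shapes, used BY NAME; what is PROVED is real arithmetic.

WHY THIS FILE EXISTS (YM-DAG node N13, -b seat `pub-ymgap-dag-n21-b`, dag-lead word [DAGLEAD-G0-REBALANCE-6B∕6C]).
The Cor 3 chain of the `B14Cor3 → B16Cor3 → B16Cor3Scales → B16Cor3Ops → B16Cor3Wilson → B16Cor3Torus` lineage ends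
(on the printed torus carrier, geometry discharged) in `B16Cor3Torus.uvIneq_of_repr172_torus`, whose effective-action
binders are
* `hA′up : ∀ V, A′(V) ≤ E′·|T₁^{(k)}|` (the upper (2.49) bookkeeping), and
* `hA′ : ∀ V, χ_k(V) ≠ 0 → −g_k⁻²A(U_k(V)) − E₁·|T₁^{(k)}| ≤ A′(V)` (the LOWER (2.49) bookkeeping on the all-small
  support — leaf L2 of [III] Cor 3, of which cell GAPS G-adv3-2 records: *no printed derivation in d = 4; derivable:
  "(L2) the lower bound of that all-small-field term: from (2.49) with Σ|Γ_j| = 0, i.e. −g_k^{−2}A(U_k) + (the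
  logarithmic terms) ≥ −g_k^{−2}A(U_k) − E₋|T_η| — derivable from the absolute-value bounds of the inductive description
  …, given that the constants E₋ may depend on g_k"*).
`B14Thm2.exp_action_two_sided`'s docstring leaves exactly *"the comparison of Σ|Γ_n| with |T_η|, the control of the
logarithmic terms and both halves of (2.50)"* to this node.  THIS FILE IS THAT ONE-LINER IN KERNEL FORM: (2.49) is typed
TWO-SIDED (`Ineq249 : |A_k + A(1/g_k², U_k) − logTerms| ≤ C·Σ_{n≤k}|Γ_n|`), so with a volume majorant
`Σ_{n≤k}|Γ_n| ≤ c_Γ·|T₁^{(k)}|` and a DISPLAYED two-sided bound on the logarithmic terms `|logTerms| ≤ c_L·|T₁^{(k)}|` both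
binders follow, with `E₁ = E′ = C·c_Γ + c_L` — and `c_L` is, by [V] (1.10) (`E_k(Λ) = (−½d(𝔤) log g_k^{−2} + log σ₀)|Λ^{(k)}∖G₀|`),
of size `½d(𝔤)·|log g_k⁻²| + |log σ₀|` per unit volume: **`g_k`-DEPENDENT, NOT uniform on `]0, γ]`** (cell GAPS G-r2.7;
[III] Cor 3 prints *"constants E₋, E₊ independent of η and T, but depending on g_k"*, [V] (0.1) prints *"independent of
k, T_η, U_k"*).  The print gap is made EXPLICIT, not closed.

WHAT IS HERE (all PROVED, [folklore]-level arithmetic over cited shapes).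
* §1 `aPrime_lower_of_ineq249`, `aPrime_upper_of_ineq249`: (2.49) two-sided + `Σ|Γ_n| ≤ c_Γ N` + the log-term bounds
  (+ `0 ≤ A(1/g_k², U_k)` for the upper shape, which drops the Wilson action) ⇒ the two binder shapes.
* §2 `abs_Ek110_le`: the (1.10) logarithmic constant per region is `≤ (½d(𝔤)|log g_k⁻²| + |log σ₀|)·#bonds` — the
  DISPLAYED `g_k`-dependence of `c_L`.
* §3 the junction with the chain: `hA'_of_ineq249` ∕ `hA'up_of_ineq249` produce LITERALLY the binders of
  `uvIneq_of_repr172(_torus)` over a `B16.RunData`, and `uvIneq_of_repr172_torus_of_ineq249` = the torus one call with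
  `(hA′, hA′up)` REPLACED by «(2.49) for every configuration + volume majorant + log-term bounds + `A ≥ 0`», constants
  `E₋ = C·c_Γ + c_L + ε`, `E₊ = C·c_Γ + c_L′ + ε′ + M⁻⁴K₀(64,8)Σe^{−c_i}`; `…_of_223` the same from the (2.23)-level leaves
  ((2.45)–(2.48) `B14.Bounds245to249`, the vacuum sentence `VacuumRestBound`) through `B14Thm2.ineq249_of_223` BY NAME.

HONEST SCOPE.  (1) `A′` of `Repr172` is ONE function of `V_k` (the lineage's typing of (1.72)'s `exp A′_k(1/(g_k(·))²,U_k)`);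
(2.49) is asked of it for every configuration with ONE volume sequence `Γ` — in the all-small reading `Γ_n = 0` (`n < k`),
`Γ_k = |T₁^{(k)}|`, `c_Γ = 1`.  (2) The logarithmic terms are an INPUT (`logT`, two-sided bounds `c_L`, `c_L′`); §2 only
displays the size [V] (1.10) gives them.  (3) Nothing is uniform in `g_k`; nothing of (2.23), (2.43)–(2.49), (1.10),
(1.72), (1.89) is asserted.  No `def … : Prop` is minted; 0 sorry; axioms standard.
-/

noncomputable section

namespace Literature.MathematicalPhysics.QuantumFieldTheory.Balaban1983to89.B16Cor3ActionBounds

open B14Thm2 (Ineq249 Eq223 VacuumRestBound ineq249_of_223)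
open B16Cor3Ops (Repr172)
open TreeLengthTorus (tsys)

/-! ## §1  (2.49) two-sided ⇒ the two effective-action binder shapes (scalars) -/

section Scalars

variable {Ak Awil logT C cΓ cL cL' N : ℝ} {Γ : ℕ → ℝ} {k : ℕ}

/-- **Lower (2.49) bookkeeping (leaf L2 of [III] Cor 3, cell GAPS G-adv3-2 (L2)).**  From (2.49) two-sided
`|A_k + A(1/g_k², U_k) − logTerms| ≤ C·Σ_{n≤k}|Γ_n|`, a volume majorant `Σ_{n≤k}|Γ_n| ≤ c_Γ·N` (`N = |T₁^{(k)}|`; all-small: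
`c_Γ = 1`), `C ≥ 0`, and a LOWER bound on the logarithmic terms `−c_L·N ≤ logTerms`:
`−A(1/g_k², U_k) − (C·c_Γ + c_L)·N ≤ A_k`. [cite: Balaban1988Convergent, (2.49)–(2.50) p.264] -/
theorem aPrime_lower_of_ineq249 (h249 : Ineq249 Ak Awil logT C Γ k)
    (hΓ : ∑ n ∈ Finset.Icc 1 k, Γ n ≤ cΓ * N) (hC : 0 ≤ C) (hlog : -(cL * N) ≤ logT) :
    -Awil - (C * cΓ + cL) * N ≤ Ak := by
  unfold Ineq249 at h249
  obtain ⟨h1, -⟩ := abs_le.mp h249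
  have h2 : C * ∑ n ∈ Finset.Icc 1 k, Γ n ≤ C * (cΓ * N) := mul_le_mul_of_nonneg_left hΓ hC
  nlinarith

/-- **Upper (2.49) bookkeeping.**  From the same two-sided (2.49), the volume majorant, `C ≥ 0`, an UPPER bound on the
logarithmic terms `logTerms ≤ c_L′·N` and `0 ≤ A(1/g_k², U_k)` (the Wilson action is non-negative — *"The first term on
the right-hand side yields the small factors"*, here simply dropped): `A_k ≤ (C·c_Γ + c_L′)·N`.
[cite: Balaban1988Convergent, (2.49)–(2.50) p.264] -/
theorem aPrime_upper_of_ineq249 (h249 : Ineq249 Ak Awil logT C Γ k)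
    (hΓ : ∑ n ∈ Finset.Icc 1 k, Γ n ≤ cΓ * N) (hC : 0 ≤ C) (hlog : logT ≤ cL' * N) (hA : 0 ≤ Awil) :
    Ak ≤ (C * cΓ + cL') * N := by
  unfold Ineq249 at h249
  obtain ⟨-, h1⟩ := abs_le.mp h249
  have h2 : C * ∑ n ∈ Finset.Icc 1 k, Γ n ≤ C * (cΓ * N) := mul_le_mul_of_nonneg_left hΓ hC
  nlinarith

/-- Both shapes in exponential form (how (2.50) consumes them pointwise): `exp(−A(1/g_k²,U_k) − (C c_Γ + c_L)N) ≤ exp A_k`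
and `exp A_k ≤ exp((C c_Γ + c_L′)N)`. [cite: Balaban1988Convergent, (2.49)–(2.50) p.264] -/
theorem exp_aPrime_two_sided (h249 : Ineq249 Ak Awil logT C Γ k)
    (hΓ : ∑ n ∈ Finset.Icc 1 k, Γ n ≤ cΓ * N) (hC : 0 ≤ C) (hlog : -(cL * N) ≤ logT) (hlog' : logT ≤ cL' * N)
    (hA : 0 ≤ Awil) :
    Real.exp (-Awil - (C * cΓ + cL) * N) ≤ Real.exp Ak ∧ Real.exp Ak ≤ Real.exp ((C * cΓ + cL') * N) :=
  ⟨Real.exp_le_exp.2 (aPrime_lower_of_ineq249 h249 hΓ hC hlog),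
    Real.exp_le_exp.2 (aPrime_upper_of_ineq249 h249 hΓ hC hlog' hA)⟩

end Scalars

/-! ## §2  The size of «the logarithmic terms»: [V] (1.10), `g_k`-dependent -/

/-- **[V] (1.10) p. 358, the logarithmic constant of one region, TWO-SIDED**: `|E_k(Λ)| = |(−½d(𝔤) log g_k^{−2} + log σ₀)|·
|Λ^{(k)}∖G₀| ≤ (½d(𝔤)·|log g_k⁻²| + |log σ₀|)·|Λ^{(k)}∖G₀|` (`B16Sect1Wilson.Ek110`, `d(𝔤) ≥ 0`) — the per-unit-volume size
of «the terms logarithmic in coupling constants» of [III] p. 264: it GROWS like `log g_k⁻²`, which is why the constants of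
§1 are `g_k`-dependent (cell GAPS G-r2.7). [cite: Balaban1989LargeFieldII, (1.10) p.358] -/
theorem abs_Ek110_le {dg : ℝ} (hdg : 0 ≤ dg) (gk σ₀ : ℝ) (n : ℕ) :
    |B16Sect1Wilson.Ek110 dg gk σ₀ n| ≤
      (1 / 2 * dg * |Real.log ((gk ^ 2)⁻¹)| + |Real.log σ₀|) * n := by
  unfold B16Sect1Wilson.Ek110
  rw [abs_mul, Nat.abs_cast]
  refine mul_le_mul_of_nonneg_right ?_ (Nat.cast_nonneg n)
  calc |-(1 / 2) * dg * Real.log (gk ^ 2)⁻¹ + Real.log σ₀|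
      ≤ |-(1 / 2) * dg * Real.log (gk ^ 2)⁻¹| + |Real.log σ₀| := abs_add_le _ _
    _ = 1 / 2 * dg * |Real.log ((gk ^ 2)⁻¹)| + |Real.log σ₀| := by
        rw [abs_mul, show |-(1 / 2) * dg| = 1 / 2 * dg by
          rw [abs_mul, abs_neg, abs_of_nonneg (by norm_num : (0 : ℝ) ≤ 1 / 2), abs_of_nonneg hdg]]

/-- Hence a sum of such constants over regions with at most `c_n·N` bonds in total is two-sided bounded by
`c_L(g_k)·N`, `c_L(g_k) = (½d(𝔤)|log g_k⁻²| + |log σ₀|)·c_n` — the shape of the binders `hlog`∕`hlog′` of §1 with the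
`g_k`-dependence displayed. [cite: Balaban1989LargeFieldII, (1.10) p.358] -/
theorem abs_Ek110_le_of_card_le {dg : ℝ} (hdg : 0 ≤ dg) (gk σ₀ : ℝ) {n : ℕ} {cn N : ℝ} (hn : (n : ℝ) ≤ cn * N) :
    |B16Sect1Wilson.Ek110 dg gk σ₀ n| ≤ (1 / 2 * dg * |Real.log ((gk ^ 2)⁻¹)| + |Real.log σ₀|) * cn * N := by
  have h0 : 0 ≤ 1 / 2 * dg * |Real.log ((gk ^ 2)⁻¹)| + |Real.log σ₀| := by positivity
  calc |B16Sect1Wilson.Ek110 dg gk σ₀ n| ≤ (1 / 2 * dg * |Real.log ((gk ^ 2)⁻¹)| + |Real.log σ₀|) * n :=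
        abs_Ek110_le hdg gk σ₀ n
    _ ≤ (1 / 2 * dg * |Real.log ((gk ^ 2)⁻¹)| + |Real.log σ₀|) * (cn * N) := mul_le_mul_of_nonneg_left hn h0
    _ = _ := by ring

/-! ## §3  The junction with the Cor 3 chain over a run -/

section Run

variable (D : B16.RunData) (k : ℕ)

/-- **The binder `hA′` of `B16Cor3Ops.Repr172.uvIneq_of_repr172`, PRODUCED** from (2.49) for the effective action
`A′` at every configuration of the all-small support (`A(1/g_k², U_k) = g_k⁻²·A(U_k(V))` = `wilsonBG`), the volume majorant
and the lower log-term bound: `∀ V, χ_k V ≠ 0 → −g_k⁻²A(U_k(V)) − (C c_Γ + c_L)·N ≤ A′(V)`.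
[cite: Balaban1988Convergent, (2.49)–(2.50) p.264] -/
theorem hA'_of_ineq249 (A' : D.Cfg k → ℝ) (logT : D.Cfg k → ℝ) {C cΓ cL : ℝ} {Γ : ℕ → ℝ}
    (hC : 0 ≤ C) (hΓ : ∑ n ∈ Finset.Icc 1 k, Γ n ≤ cΓ * (D.numSites k : ℝ))
    (h249 : ∀ V, D.χ k V ≠ 0 → Ineq249 (A' V) (1 / (D.flow.g k) ^ 2 * D.wilsonBG k V) (logT V) C Γ k)
    (hlog : ∀ V, D.χ k V ≠ 0 → -(cL * (D.numSites k : ℝ)) ≤ logT V) :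
    ∀ V, D.χ k V ≠ 0 →
      -(1 / (D.flow.g k) ^ 2 * D.wilsonBG k V) - (C * cΓ + cL) * (D.numSites k : ℝ) ≤ A' V :=
  fun V hV => aPrime_lower_of_ineq249 (h249 V hV) hΓ hC (hlog V hV)

/-- **The binder `hA′up`, PRODUCED** from (2.49) at every configuration, the volume majorant, the upper log-term bound
and `0 ≤ A(U_k(V))`: `∀ V, A′(V) ≤ (C c_Γ + c_L′)·N`. [cite: Balaban1988Convergent, (2.49)–(2.50) p.264] -/
theorem hA'up_of_ineq249 (A' : D.Cfg k → ℝ) (logT : D.Cfg k → ℝ) {C cΓ cL' : ℝ} {Γ : ℕ → ℝ}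
    (hC : 0 ≤ C) (hΓ : ∑ n ∈ Finset.Icc 1 k, Γ n ≤ cΓ * (D.numSites k : ℝ))
    (h249 : ∀ V, Ineq249 (A' V) (1 / (D.flow.g k) ^ 2 * D.wilsonBG k V) (logT V) C Γ k)
    (hlog' : ∀ V, logT V ≤ cL' * (D.numSites k : ℝ)) (hA0 : ∀ V, 0 ≤ D.wilsonBG k V) :
    ∀ V, A' V ≤ (C * cΓ + cL') * (D.numSites k : ℝ) :=
  fun V => aPrime_upper_of_ineq249 (h249 V) hΓ hC (hlog' V) (by have := hA0 V; positivity)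

/-- **THE TORUS ONE CALL OF THE COR 3 CHAIN WITH THE TWO EFFECTIVE-ACTION BINDERS REPLACED BY (2.49)** —
`B16Cor3Torus.uvIneq_of_repr172_torus` (geometry discharged: Δ = 8, c₀ = 64, `κ₁ ≥ κ₀(64,8)`, cube count via `hnum`) with
`hA′`∕`hA′up` supplied by §1: inputs (2.49) for `A′` at every configuration (`h249`), the volume majorant `hΓ`, the two
log-term bounds `hlog`∕`hlog′` and `A(U_k(V)) ≥ 0`; conclusion `B16.UVIneq` at every configuration with
`E₋ = C·c_Γ + c_L + ε`, `E₊ = C·c_Γ + c_L′ + ε′ + M⁻⁴·K₀(64,8)·Σ_i e^{−c_i}` — BOTH `g_k`-DEPENDENT through `c_L`, `c_L′`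
(§2).  Every other binder ((1.72) datum, χ dictionary, factor leaves, curly bracket, (1.100) summed) verbatim.
CONDITIONAL on all of them; nothing of Bałaban's asserted. [cite: Balaban1989LargeFieldII, (0.1) p.356 and p.387 after (1.89)] -/
theorem uvIneq_of_repr172_torus_of_ineq249 (N : ℕ) [NeZero N] (R : Repr172 (D.Cfg k) (tsys 4 N).Dom)
    {M : ℝ} (hM : M ≠ 0) (hnum : (D.numSites k : ℝ) = (M * N) ^ 4)
    {κ₁ : ℝ} (hκ : B12TreeDecay.kappa₀ (4 * 2 ^ 4) (2 * 4) ≤ κ₁)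
    (c : Fin 2 → ℝ) (Rre : D.Cfg k → ℝ) (ε ε' : ℝ)
    (hH : R.Holds (D.ρ k))
    (hχ01 : ∀ a V, 0 ≤ R.χ a V ∧ R.χ a V ≤ 1)
    (h0χ : ∀ V, R.χ R.allSmall V = D.χ k V)
    (hZ : ∀ a V, (R.TZ a).T 1 V ≤ ∏ X ∈ R.Zc a, Real.exp (-(c 0) - κ₁ * (tsys 4 N).dj X))
    (hY : ∀ a V, (R.TYs a).T 1 V ≤ ∏ Y ∈ R.Ys a, Real.exp (-(c 1) - κ₁ * (tsys 4 N).dj Y))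
    (hcurly : ∀ a V, 0 ≤ R.curly a V ∧ R.curly a V ≤ Real.exp (ε' * (D.numSites k : ℝ)))
    (h0c : ∀ V, R.curly R.allSmall V = Real.exp (Rre V))
    (hR : ∀ V, |Rre V| ≤ ε * (D.numSites k : ℝ))
    -- (2.49) for the effective action `A′` and its logarithmic terms, replacing `hA′`, `hA′up`
    (logT : D.Cfg k → ℝ) {C cΓ cL cL' : ℝ} {Γ : ℕ → ℝ} (hC : 0 ≤ C)
    (hΓ : ∑ n ∈ Finset.Icc 1 k, Γ n ≤ cΓ * (D.numSites k : ℝ))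
    (h249 : ∀ V, Ineq249 (R.A' V) (1 / (D.flow.g k) ^ 2 * D.wilsonBG k V) (logT V) C Γ k)
    (hlog : ∀ V, -(cL * (D.numSites k : ℝ)) ≤ logT V) (hlog' : ∀ V, logT V ≤ cL' * (D.numSites k : ℝ))
    (hA0 : ∀ V, 0 ≤ D.wilsonBG k V) :
    ∀ V : D.Cfg k, B16.UVIneq D k V (C * cΓ + cL + ε)
      (C * cΓ + cL' + ε' + M⁻¹ ^ 4 * B12TreeDecay.K₀ (4 * 2 ^ 4) (2 * 4) * ∑ i, Real.exp (-(c i))) :=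
  B16Cor3Torus.uvIneq_of_repr172_torus D k N R hM hnum hκ c Rre (C * cΓ + cL) ε ε' (C * cΓ + cL') hH hχ01 h0χ hZ hY
    (hA'up_of_ineq249 D k R.A' logT hC hΓ h249 hlog' hA0) hcurly h0c hR
    (hA'_of_ineq249 D k R.A' logT hC hΓ (fun V _ => h249 V) (fun V _ => hlog V))

/-- **… and from the (2.23)-level leaves**: (2.23) `A′ = −A(1/g_k²,U_k) + 𝐄_k + 𝐑_k + 𝐁_k − E_k` at every configuration,
(2.45)–(2.48) in the tree's shape `B14.Bounds245to249` (printed binder `κ₀ ≥ 7`), the vacuum-energy sentence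
`VacuumRestBound` (`E_k = EkLog + EkRest`, `|EkRest| ≤ E₂Σ|Γ_n|`), through `B14Thm2.ineq249_of_223` BY NAME — the
logarithmic terms being `−EkLog` with the two-sided bound `|EkLog| ≤ c_L·N` (§2's shape).  Constants:
`E₋ = C₂₄₉·c_Γ + c_L + ε`, `E₊ = C₂₄₉·c_Γ + c_L + ε′ + M⁻⁴K₀(64,8)Σe^{−c_i}`, `C₂₄₉ = E₁(1 − L^{−β})⁻¹ + 1 + 2B₁ + E₂`.
[cite: Balaban1988Convergent, (2.23) p.258 and (2.49)–(2.50) p.264] -/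
theorem uvIneq_of_repr172_torus_of_223 (N : ℕ) [NeZero N] (R : Repr172 (D.Cfg k) (tsys 4 N).Dom)
    {M : ℝ} (hM : M ≠ 0) (hnum : (D.numSites k : ℝ) = (M * N) ^ 4)
    {κ₁ : ℝ} (hκ : B12TreeDecay.kappa₀ (4 * 2 ^ 4) (2 * 4) ≤ κ₁)
    (c : Fin 2 → ℝ) (Rre : D.Cfg k → ℝ) (ε ε' : ℝ)
    (hH : R.Holds (D.ρ k))
    (hχ01 : ∀ a V, 0 ≤ R.χ a V ∧ R.χ a V ≤ 1)
    (h0χ : ∀ V, R.χ R.allSmall V = D.χ k V)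
    (hZ : ∀ a V, (R.TZ a).T 1 V ≤ ∏ X ∈ R.Zc a, Real.exp (-(c 0) - κ₁ * (tsys 4 N).dj X))
    (hY : ∀ a V, (R.TYs a).T 1 V ≤ ∏ Y ∈ R.Ys a, Real.exp (-(c 1) - κ₁ * (tsys 4 N).dj Y))
    (hcurly : ∀ a V, 0 ≤ R.curly a V ∧ R.curly a V ≤ Real.exp (ε' * (D.numSites k : ℝ)))
    (h0c : ∀ V, R.curly R.allSmall V = Real.exp (Rre V))
    (hR : ∀ V, |Rre V| ≤ ε * (D.numSites k : ℝ))
    -- the (2.23)-level leaves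
    {κ₀ : ℕ} (hκ₀ : 7 ≤ κ₀) (Etot Rtot Btot : D.Cfg k → ℝ) (EkLog EkRest E₁ R₁ B₁ L β E₂ : ℝ) (Γ : ℕ → ℝ)
    (hE₁ : 0 ≤ E₁) (hL : 0 ≤ (1 - L ^ (-β))⁻¹) (hB₁ : 0 ≤ B₁) (hE₂ : 0 ≤ E₂)
    (h223 : ∀ V, Eq223 (R.A' V) (1 / (D.flow.g k) ^ 2 * D.wilsonBG k V) (Etot V) (Rtot V) (Btot V) (EkLog + EkRest))
    (hB : ∀ V, B14.Bounds245to249 (Etot V) (Rtot V) (Btot V) E₁ R₁ B₁ L β D.flow.g κ₀ Γ k)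
    (hvac : VacuumRestBound EkRest E₂ Γ k) {cΓ cL : ℝ}
    (hΓ : ∑ n ∈ Finset.Icc 1 k, Γ n ≤ cΓ * (D.numSites k : ℝ)) (hlog : |EkLog| ≤ cL * (D.numSites k : ℝ))
    (hA0 : ∀ V, 0 ≤ D.wilsonBG k V) :
    ∀ V : D.Cfg k, B16.UVIneq D k V ((E₁ * (1 - L ^ (-β))⁻¹ + 1 + 2 * B₁ + E₂) * cΓ + cL + ε)
      ((E₁ * (1 - L ^ (-β))⁻¹ + 1 + 2 * B₁ + E₂) * cΓ + cL + ε' +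
        M⁻¹ ^ 4 * B12TreeDecay.K₀ (4 * 2 ^ 4) (2 * 4) * ∑ i, Real.exp (-(c i))) := by
  have hC : 0 ≤ E₁ * (1 - L ^ (-β))⁻¹ + 1 + 2 * B₁ + E₂ := by positivity
  have h249 : ∀ V, Ineq249 (R.A' V) (1 / (D.flow.g k) ^ 2 * D.wilsonBG k V) (-EkLog)
      (E₁ * (1 - L ^ (-β))⁻¹ + 1 + 2 * B₁ + E₂) Γ k := fun V =>
    ineq249_of_223 k κ₀ hκ₀ (R.A' V) _ (Etot V) (Rtot V) (Btot V) EkLog EkRest E₁ R₁ B₁ L β E₂ D.flow.g Γ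
      (h223 V) (hB V) hvac
  obtain ⟨hl1, hl2⟩ := abs_le.mp hlog
  exact uvIneq_of_repr172_torus_of_ineq249 D k N R hM hnum hκ c Rre ε ε' hH hχ01 h0χ hZ hY hcurly h0c hR
    (fun _ => -EkLog) hC hΓ h249 (fun V => by linarith) (fun V => by linarith) hA0

end Run

end Literature.MathematicalPhysics.QuantumFieldTheory.Balaban1983to89.B16Cor3ActionBounds

end
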